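import Summits.BirchSwinnertonDyer.BirchSwinnertonDyer.Theses.ByReductionTypeAtTwo
import Summits.BirchSwinnertonDyer.BirchSwinnertonDyer.Theorems.ByReductionTypeAtTwoLambdaConstPinch
import Summits.BirchSwinnertonDyer.Rank1Residual.Supersingular.BlindInterpolationFlatTwoUnit
import Summits.BirchSwinnertonDyer.Rank1Residual.Supersingular.FrobeniusTraceTwoParity
import Summits.BirchSwinnertonDyer.Rank1Residual.P2.EmptyCellsAtTwo
import Literature.NumberTheory.EllipticCurves.Sprung2017.SharpFlatPAdicLFunctionTwoProofs
import HarnessLib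

/-!
# Route `ByReductionTypeAtTwo` (rung K4), crux `SupersingularRankZeroAtTwo` (item
# stmt-BirchSwinnertonDyer-19097): the TYPED OBSTRUCTION — the datum-level `♭` package at `p = 2`,
# ∀-closed over the class, is EQUIVALENT to the crux (kernel certificate; seat `bsd-2adic-ss-1`)

HONEST FRAMING (cell `bsd-2adic`, run/shared/lean/pub/bsd-2adic/, HUMAN RULING D-0074 «… or its typed
obstruction as a Negative lemma»): THEOREMS ONLY, about the tree's hypothesis structure
`SignedDatum W 2` (`Supersingular/SignedRankZero.lean`), Sprung's REAL pair at `2` (`IsSprungPair f 2`,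
exists by `exists_isSprungPair_two`) and the REGISTERED crux constant; every published input named
(Abbes–Ullmo Thm. A `hAU`, modularity `hmod`/`hmod'`, GZK `hGZK`); nothing asserted about any curve;
no definition, no named fact; nothing booked; no label moves. PARTITION (D-0054): X5@2 good-ss
(B1·O1; 763 book230 classes) × p = 2 — types-the-object-of (an obstruction certificate); closes none.

WHAT IS CERTIFIED. The only typed ±/signed inputs at `2` the tree has for `a₂ = ±2` are DATUM-level:
a `SignedDatum W 2 = (ξ, L, c)` whose `L` is bound to Sprung's real `L♭` at `2`, with Kim's Euler
characteristic (K) ON THE DATUM `ξ` and a signed divisibility / main-conjecture equality `(L) = (ξ)`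
(the binders `hK`, `hdiv` of the `♭`-doors `BlindLever.bsdp_two_of_oneDivisibility_of_blindControl_flat*`;
no algebraic `♭`-Selmer object at `2` exists in the tree or in print — Sprung, JNT 132 (2012) §7,
p. 1499: "From now on, assume `p` is odd"). This file proves that, per curve and ∀-closed over the
class, THAT PACKAGE IS EQUIVALENT TO BSD₂ / TO THE CRUX (granted Abbes–Ullmo + modularity + GZK):

* `interpolationUnit_flat_two_of_goodSS` — (P′) at `2` for all three traces: `L♭(0) = v·L(E,1)/Ω_E`,
  `v = (−a₂² + 2a₂ + 1)·(Ω_E/Ω⁺_f)` a `2`-adic unit (`k ∈ {1, 1, −7}`; the tree's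
  `interpolationUnit_flat_two` is the `a₂ = ±2` case);
* `bsdp_two_of_flatDatumPackage` — package ⇒ `BSD(E,2)` (unit renormalisation `SignedDatum.unitRescale`,
  both divisibilities from the equality, the tree's rank-`0` signed chain; `E[2]` irreducible by
  `P2.irr_two_of_goodSS_two`);
* `flatDatumPackage_of_bsdp_two` — `BSD(E,2)` ⇒ package, with the TRIVIAL datum `(L♭, L♭, 1)`:
  (K) holds because `v₂ L♭(0) = v₂(L(E,1)/Ω_E) = v₂ ∏c_ℓ + v₂ #Ш = v₂ ∏c_ℓ + v₂ #Sel_{2^∞}(E/ℚ)`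
  and two `2`-adic integers of equal norm are associated (`LambdaConstPinch.exists_units_mul_eq_of_norm_eq`);
* `flatDatumPackage_two_iff_bsdp` (per curve) and **`supersingularRankZeroAtTwo_iff_flatDatumPackage`**
  (class level): the crux ⟺ the ∀-closed datum-level package.

READING (for the planner / T1 refuter): a split of the crux into datum-level `♭` halves would be
`t1c-degenerate` — a restatement; the research content of the `a₂ = ±2` branch is the CONSTRUCTION of
`X♭(E/ℚ_∞)` at `2` with its control / Euler-characteristic theory (MATH-BOUND), after which (K) and
`(L♭) = (ξ♭)` become statements about a real object, exactly as on the `a₂ = 0` branch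
(`KobayashiMainConjecture W 2 1`, sibling file `ByReductionTypeAtTwoSupersingularInputs.lean`).

References: [AbbesUllmo1996] Thm. A; [Sprung2012] §7; [Sprung2017] §1.1, Thm. 1.12, Cor. 4.11;
[Kobayashi2003] §3, Thm. 1.2; [Miller2011LMS] Def. 1.1.
-/

set_option autoImplicit false
-- the Theorems namespace of this sub repeats the summit name by design (D-0017 nested layout)
set_option linter.dupNamespace false

noncomputable section

open scoped Classical MatrixGroups ModularForm

open CongruenceSubgroup WeierstrassCurve Literature.NumberTheory.EllipticCurves
  Literature.NumberTheory.EllipticCurves.ModularForms Literature.NumberTheory.EllipticCurves.Sprung2017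
  Literature.NumberTheory.EllipticCurves.Rank1Residual Literature.NumberTheory.EllipticCurves.Rank1Residual.Typed
  Summit.BirchSwinnertonDyer.Rank1Residual Summit.BirchSwinnertonDyer.Rank1Residual.Supersingular

namespace Summit.BirchSwinnertonDyer.BirchSwinnertonDyer.Theorems

/-! ## The DATUM-level `♭` package at `2` is BSD₂-equivalent (the typed obstruction at `a₂ = ±2`) -/

section Degeneracy

variable {N : ℕ} [NeZero N] {f : CuspForm (Gamma0 N) 2}
  (W : WeierstrassCurve ℚ) [W.IsElliptic] [W.IsGloballyMinimal]

/-- (P′) at `p = 2` for ALL THREE traces `a₂ ∈ {0, 2, −2}`: for `f` the newform of `E = W` (good at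
`2`), ANY Sprung pair `(Ls, D.L)` at `2` and a `2`-adic-unit period ratio `Ω_E = u·Ω⁺_f`:
`D.L(0) = v · L(E,1)/Ω_E` with `v = (−a₂² + 2a₂ + 1)·u ∈ ℚ` a `2`-adic unit (`k = 1, 1, −7`). The
tree's `interpolationUnit_flat_two` is the `a₂ = ±2` case; the proof is the same.
[cite: Sprung2017, Thm. 1.12, Cor. 4.4 and Cor. 4.11 (row p = 2)] -/
theorem interpolationUnit_flat_two_of_goodSS (hf : IsNewformOf W f) (hgood : W.HasGoodReductionAtPrime 2)
    (hss : (2 : ℤ) ∣ W.frobeniusTrace 2) (D : SignedDatum W 2)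
    {Ls : IwasawaAlgebra 2} (hSP : IsSprungPair f 2 (W.frobeniusTrace 2) Ls D.L)
    (hu : ∃ u : ℚ, ‖(u : ℚ_[2])‖ = 1 ∧ W.realPeriodRat = u * plusPeriod f) :
    ∃ t : ℚ, W.entireLFunction 1 / (W.realPeriodRat : ℂ) = (t : ℂ) ∧
      ∃ v : ℚ, ‖(v : ℚ_[2])‖ = 1 ∧
        ((PowerSeries.constantCoeff D.L : ℤ_[2]) : ℚ_[2]) = (v : ℚ_[2]) * ((t : ℚ) : ℚ_[2]) := by
  obtain ⟨u, hu1, hΩ⟩ := hu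
  have hΩpos : 0 < W.realPeriodRat := W.realPeriodRat_pos_holds
  have hu0 : u ≠ 0 := by rintro rfl; simp at hu1
  have huC : ((u : ℚ) : ℂ) ≠ 0 := by exact_mod_cast hu0
  have hk : (-(W.frobeniusTrace 2) ^ 2 + 2 * W.frobeniusTrace 2 + 1 : ℤ) = 1 ∨
      (-(W.frobeniusTrace 2) ^ 2 + 2 * W.frobeniusTrace 2 + 1 : ℤ) = -7 := by
    rcases frobeniusTrace_two_eq_zero_or W hgood hss with h | h | h <;> rw [h] <;> norm_num
  set k : ℤ := -(W.frobeniusTrace 2) ^ 2 + 2 * W.frobeniusTrace 2 + 1 with hk_def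
  have hkdvd : ¬ (2 : ℤ) ∣ k := by rcases hk with h | h <;> rw [h] <;> decide
  have hk1 : ‖((k : ℤ) : ℚ_[2])‖ = 1 :=
    le_antisymm (Padic.norm_int_le_one k) (not_lt.mp (mt Padic.norm_intCast_lt_one_iff.mp hkdvd))
  refine ⟨ratPlusSymbol f 0 / u, ?_, (k : ℚ) * u, ?_, ?_⟩
  · rw [hf.entireLFunction_one_eq, div_eq_iff (Complex.ofReal_ne_zero.mpr hΩpos.ne'), hΩ]
    push_cast; rw [div_mul_eq_mul_div, eq_div_iff huC]; ring
  · rw [show ((((k : ℚ) * u : ℚ)) : ℚ_[2]) = ((k : ℤ) : ℚ_[2]) * ((u : ℚ) : ℚ_[2]) by push_cast; ring,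
      norm_mul, hk1, hu1, mul_one]
  · rw [constantCoeff_flat_two_of_isSprungPair_of_isNewformOf hf hgood hSP, ← Rat.cast_mul]
    congr 1
    rw [hk_def, mul_assoc, mul_div_cancel₀ _ hu0]; push_cast; ring

/-- **Datum-level `♭` package ⇒ `BSD(E,2)` (per curve, any `a₂ ∈ {0, ±2}`).** For `E = W` with good
supersingular reduction at `2` and `L(E,1) ≠ 0`, a signed datum `D = (ξ, L, c)` whose `L` IS the `♭`
member of a Sprung pair at `2` of the newform `f`, with Kim's Euler characteristic (K) for `ξ` and
the main-conjecture EQUALITY `(L) = (ξ)` in `Λ`, gives `BSD(E,2)` — granted Abbes–Ullmo (`hAU`, PUB: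
the period ratio is a `2`-adic unit) and GZK. (P) and `2 ∤ c` are DERIVED by unit renormalisation
(`interpolationUnit_flat_two_of_goodSS`, `SignedDatum.unitRescale`); `E[2]` irreducible by
`P2.irr_two_of_goodSS_two`. The door WITHOUT the blind point: both divisibilities come from the
equality. [cite: AbbesUllmo1996, Thm. A] [cite: Kobayashi2003, §3 and Thm. 1.2] [cite: Miller2011LMS, Def. 1.1] -/
theorem bsdp_two_of_flatDatumPackage (hAU : abbesUllmo_not_dvd_maninConstant_of_not_dvd_level)
    (hGZK : rank_eq_analyticRank_of_analyticRank_le_one)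
    (hgood : W.HasGoodReductionAtPrime 2) (hss : (2 : ℤ) ∣ W.frobeniusTrace 2)
    (hL : W.entireLFunction 1 ≠ 0) (hf : IsNewformOf W f) (D : SignedDatum W 2)
    {Ls : IwasawaAlgebra 2} (hSP : IsSprungPair f 2 (W.frobeniusTrace 2) Ls D.L)
    (hK : D.EulerCharacteristic) (heq : Ideal.span {D.L} = Ideal.span {D.xi}) : BSDp W 2 := by
  have hr : W.analyticRank = 0 := analyticRank_eq_zero_of_entireLFunction_one_ne_zero W hL
  have hirr : W.HasIrreducibleModPGaloisRep 2 := P2.irr_two_of_goodSS_two W ⟨hgood, hss⟩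
  obtain ⟨t, ht, v, hv, hLt⟩ := interpolationUnit_flat_two_of_goodSS W hf hgood hss D hSP
    (SkinnerUrban2014.realPeriodRat_eq_unit_mul_plusPeriod_two_of_abbesUllmo hAU W hgood hirr f hf)
  obtain ⟨hLxi, hxiL⟩ := BlindLever.dvd_and_dvd_of_span_eq_span heq
  set D' := D.unitRescale (PadicInt.mkUnits hv)⁻¹ with hD'
  have hc' : ¬ 2 ∣ D'.c := D.not_dvd_unitRescale_c _
  have hK' : D'.EulerCharacteristic := (D.eulerCharacteristic_unitRescale_iff _).mpr hK
  have hP' : D'.Interpolation := D.interpolation_unitRescale_of_unit hv ht hLt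
  have hlow : D'.LowerDivisibility := (D.lowerDivisibility_unitRescale_iff _).mpr hLxi
  have hup : D'.UpperDivisibility := (D.upperDivisibility_unitRescale_iff _).mpr hxiL
  exact bsdp_of_missingPPartAt W 2 hGZK (by omega)
    (missingPPartAt_of_lower_of_upper W 2
      (missingLowerBoundAt_of_signedLowerDivisibility W 2 hGZK hirr hL D' hc' hK' hP' hlow)
      (missingUpperBoundAt_of_signedUpperDivisibility W 2 hGZK hirr hL D' hc' hK' hP' hup))

/-- **`BSD(E,2)` ⇒ the datum-level `♭` package (per curve).** Conversely, if `BSD(E,2)` holds (with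
`L(E,1) ≠ 0`, good supersingular `2`), then for EVERY Sprung pair `(L♯, L♭)` at `2` of the newform `f`
the datum `D := (L♭, L♭, 1)` satisfies the package: `(L) = (ξ)` trivially, and (K) because
`v₂ L♭(0) = v₂(k·[0]⁺_f) = v₂(L(E,1)/Ω_E) = v₂ ∏c_ℓ + v₂ #Ш = v₂ ∏c_ℓ + v₂ #Sel_{2^∞}(E/ℚ)`
(`k` odd, Abbes–Ullmo, BSD₂ read through `missingPPartAt_of_bsdp`, `E(ℚ)[2] = 0`, GZK with
`#Sel_{2^∞} = #Ш[2^∞]`), and two `2`-adic integers of equal norm are associated. So at the DATUM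
level the `♭` package carries NO class-level information beyond BSD₂ itself: the research content of
the `a₂ = ±2` branch is the CONSTRUCTION of the algebraic `♭`-object at `2` (Sprung's `X♭(E/ℚ_∞)`,
in print for odd `p` only), not the package. [cite: AbbesUllmo1996, Thm. A] [cite: Miller2011LMS, Def. 1.1]
[cite: Sprung2012, §7 (p. 1499)] -/
theorem flatDatumPackage_of_bsdp_two (hAU : abbesUllmo_not_dvd_maninConstant_of_not_dvd_level)
    (hGZK : rank_eq_analyticRank_of_analyticRank_le_one)
    (hgood : W.HasGoodReductionAtPrime 2) (hss : (2 : ℤ) ∣ W.frobeniusTrace 2)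
    (hL : W.entireLFunction 1 ≠ 0) (hf : IsNewformOf W f)
    {Ls Lf : IwasawaAlgebra 2} (hSP : IsSprungPair f 2 (W.frobeniusTrace 2) Ls Lf) (hB : BSDp W 2) :
    ∃ D : SignedDatum W 2, D.L = Lf ∧ D.EulerCharacteristic ∧ Ideal.span {D.L} = Ideal.span {D.xi} := by
  have hr : W.analyticRank = 0 := analyticRank_eq_zero_of_entireLFunction_one_ne_zero W hL
  have hirr : W.HasIrreducibleModPGaloisRep 2 := P2.irr_two_of_goodSS_two W ⟨hgood, hss⟩
  refine ⟨⟨Lf, Lf, 1⟩, rfl, ?_, rfl⟩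
  intro hfin
  -- GZK: rank 0, `Ш` finite, `#Sel_{2^∞} = #Ш[2^∞]`
  have hr0 : W.mordellWeilRank = 0 := (hGZK W (by omega)).1.trans hr
  haveI hfinE : Finite W.toAffine.Point := W.mordellWeilRank_eq_zero_iff_finite.mp hr0
  haveI hfinSha : Finite W.sha := (hGZK W (by omega)).2
  have hSel : Nat.card (W.selmerGroupPInfty 2) = Nat.card (AddCommGroup.primaryComponent W.sha 2) :=
    W.natCard_selmerGroupPInfty_eq_natCard_primaryComponent_sha 2
  -- (P′): `Lf(0) = v · t`, `v` a `2`-adic unit, `t = L(E,1)/Ω_E`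
  obtain ⟨t, ht, v, hv, hLt⟩ := interpolationUnit_flat_two_of_goodSS W hf hgood hss ⟨Lf, Lf, 1⟩ hSP
    (SkinnerUrban2014.realPeriodRat_eq_unit_mul_plusPeriod_two_of_abbesUllmo hAU W hgood hirr f hf)
  -- BSD₂: `v₂ t − v₂ ∏c = v₂ #Ш`
  obtain ⟨q, hq, hvq⟩ := missingPPartAt_of_bsdp W 2 hB
  have hqt : q = t * (W.torsionOrder : ℚ) ^ 2 / (W.tamagawaProduct : ℚ) := by
    have h := hq.symm.trans (shaAn_eq_of_analyticRank_eq_zero W hGZK hr ht)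
    exact_mod_cast h
  have ht0 : t ≠ 0 := by
    rintro rfl
    have hΩC : (W.realPeriodRat : ℂ) ≠ 0 := Complex.ofReal_ne_zero.mpr W.realPeriodRat_pos_holds.ne'
    apply hL
    have h1 := ht
    rw [Rat.cast_zero, div_eq_iff hΩC] at h1
    simpa using h1
  rw [hqt, padicValRat_shaAn_witness W 2 hirr ht0] at hvq
  -- the two sides of (K) as non-zero elements of `ℚ₂` with equal valuation
  have hv0 : ((v : ℚ) : ℚ_[2]) ≠ 0 := by
    intro h0; rw [h0, norm_zero] at hv; exact zero_ne_one hv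
  have htQ : ((t : ℚ) : ℚ_[2]) ≠ 0 := by exact_mod_cast ht0
  have hLne : ((PowerSeries.constantCoeff Lf : ℤ_[2]) : ℚ_[2]) ≠ 0 := by
    rw [show (⟨Lf, Lf, 1⟩ : SignedDatum W 2).L = Lf from rfl] at hLt
    rw [hLt]; exact mul_ne_zero hv0 htQ
  have hcardpos : 0 < Nat.card (W.selmerGroupPInfty 2) := by
    haveI := hfin; exact Nat.card_pos
  have hpT : ((2 : ℕ) : ℚ_[2]) ^ (padicValNat 2 W.tamagawaProduct) =
      ((2 ^ (padicValNat 2 W.tamagawaProduct) : ℕ) : ℚ_[2]) := by norm_cast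
  have hy0 : ((2 ^ (padicValNat 2 W.tamagawaProduct) : ℕ) : ℚ_[2]) *
      (Nat.card (W.selmerGroupPInfty 2) : ℚ_[2]) ≠ 0 := by
    refine mul_ne_zero ?_ ?_
    · exact_mod_cast pow_ne_zero _ two_ne_zero
    · exact_mod_cast hcardpos.ne'
  -- valuations
  have hvalL : (((PowerSeries.constantCoeff Lf : ℤ_[2]) : ℚ_[2])).valuation = padicValRat 2 t := by
    rw [show (⟨Lf, Lf, 1⟩ : SignedDatum W 2).L = Lf from rfl] at hLt
    rw [hLt, Padic.valuation_mul hv0 htQ, Padic.valuation_ratCast, Padic.valuation_ratCast]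
    have : padicValRat 2 v = 0 := by
      have h := Padic.norm_eq_zpow_neg_valuation hv0
      rw [hv] at h
      have h' := (zpow_right_injective₀ (by norm_num : (0:ℝ) < 2) (by norm_num : (2:ℝ) ≠ 1)).eq_iff.mp
        ((zpow_zero (2:ℝ)).trans h)
      rw [Padic.valuation_ratCast] at h'
      omega
    rw [this, zero_add]
  have hvalR : ((((2 ^ (padicValNat 2 W.tamagawaProduct) : ℕ) : ℚ_[2]) *
      (Nat.card (W.selmerGroupPInfty 2) : ℚ_[2]))).valuation =
        (padicValNat 2 W.tamagawaProduct : ℤ) + padicValNat 2 W.shaOrder := by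
    rw [Padic.valuation_mul (by exact_mod_cast pow_ne_zero _ two_ne_zero) (by exact_mod_cast hcardpos.ne'),
      Padic.valuation_natCast, Padic.valuation_natCast, padicValNat.prime_pow, hSel,
      padicValNat_card_addPrimaryComponent (A := W.sha) 2, WeierstrassCurve.shaOrder]
  have hveq : (((PowerSeries.constantCoeff Lf : ℤ_[2]) : ℚ_[2])).valuation =
      ((((2 ^ (padicValNat 2 W.tamagawaProduct) : ℕ) : ℚ_[2]) *
        (Nat.card (W.selmerGroupPInfty 2) : ℚ_[2]))).valuation := by
    rw [hvalL, hvalR]; linarith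
  -- equal valuation in `ℤ₂` ⇒ associated
  set y : ℤ_[2] := ((2 ^ (padicValNat 2 W.tamagawaProduct) : ℕ) : ℤ_[2]) *
    (Nat.card (W.selmerGroupPInfty 2) : ℤ_[2]) with hy_def
  have hycoe : ((y : ℤ_[2]) : ℚ_[2]) = ((2 ^ (padicValNat 2 W.tamagawaProduct) : ℕ) : ℚ_[2]) *
      (Nat.card (W.selmerGroupPInfty 2) : ℚ_[2]) := by
    rw [hy_def, PadicInt.coe_mul, PadicInt.coe_natCast, PadicInt.coe_natCast]
  have hy0' : ((y : ℤ_[2]) : ℚ_[2]) ≠ 0 := by rw [hycoe]; exact hy0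
  have hnorm : ‖(PowerSeries.constantCoeff Lf : ℤ_[2])‖ = ‖y‖ :=
    BlindLever.norm_eq_norm_of_coe_valuation_eq hLne hy0' (by rw [hycoe]; exact hveq)
  obtain ⟨w, hw⟩ := LambdaConstPinch.exists_units_mul_eq_of_norm_eq
    (fun h0 ↦ hLne (by rw [h0]; rfl)) (fun h0 ↦ hy0' (by rw [h0]; rfl)) hnorm
  refine ⟨w, ?_⟩
  show ((PowerSeries.constantCoeff Lf : ℤ_[2]) : ℚ_[2]) = _
  rw [hw, PadicInt.coe_mul, hycoe, hpT]
  ring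

/-- **The typed obstruction, per curve: datum-level `♭` package at `2` ⟺ `BSD(E,2)`** (good
supersingular `2`, any `a₂ ∈ {0, ±2}`, `L(E,1) ≠ 0`; granted Abbes–Ullmo and GZK; for any Sprung pair
of any newform of `E`). [cite: AbbesUllmo1996, Thm. A] [cite: Miller2011LMS, Def. 1.1] -/
theorem flatDatumPackage_two_iff_bsdp (hAU : abbesUllmo_not_dvd_maninConstant_of_not_dvd_level)
    (hGZK : rank_eq_analyticRank_of_analyticRank_le_one)
    (hgood : W.HasGoodReductionAtPrime 2) (hss : (2 : ℤ) ∣ W.frobeniusTrace 2)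
    (hL : W.entireLFunction 1 ≠ 0) (hf : IsNewformOf W f)
    {Ls Lf : IwasawaAlgebra 2} (hSP : IsSprungPair f 2 (W.frobeniusTrace 2) Ls Lf) :
    (∃ D : SignedDatum W 2, D.L = Lf ∧ D.EulerCharacteristic ∧ Ideal.span {D.L} = Ideal.span {D.xi}) ↔
      BSDp W 2 := by
  constructor
  · rintro ⟨D, hDL, hK, heq⟩
    subst hDL
    exact bsdp_two_of_flatDatumPackage W hAU hGZK hgood hss hL hf D hSP hK heq
  · exact flatDatumPackage_of_bsdp_two W hAU hGZK hgood hss hL hf hSP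

/-- **THE TYPED OBSTRUCTION, CLASS LEVEL: the crux is EQUIVALENT to the ∀-closed datum-level `♭`
package at `2`.** Granted the PUBLISHED facts Abbes–Ullmo (`hAU`), modularity (`hmod` for the
newform, `hmod'` for `L(E,1) ≠ 0 ⟺ r_an = 0`) and GZK: `SupersingularRankZeroAtTwo` holds iff for every non-CM `E` of
analytic rank `0` with good supersingular reduction at `2`, every newform `f` of `E` and every Sprung
pair `(L♯, L♭)` at `2` there is a signed datum with `L = L♭`, Kim's (K) and `(L) = (ξ)`. Reading: the
tree's typed ±/signed inputs at `2` that exist for `a₂ = ±2` (a DATUM `ξ` with (K) and a signed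
divisibility/equality against the REAL `L♭`) are, ∀-closed over the class, a RESTATEMENT of the crux
— no weaker typed sufficient condition is available at `2` without the algebraic `♭`-object
(MATH-BOUND; Sprung 2012 §7 "`p` odd"). Nothing asserted; no label moves.
[cite: AbbesUllmo1996, Thm. A] [cite: Sprung2012, §7 (p. 1499)] [cite: Miller2011LMS, Def. 1.1] -/
theorem supersingularRankZeroAtTwo_iff_flatDatumPackage
    (hAU : abbesUllmo_not_dvd_maninConstant_of_not_dvd_level)
    (hmod : nonempty_modularParametrizationData) (hmod' : hasEntireLFunction_rat)
    (hGZK : rank_eq_analyticRank_of_analyticRank_le_one) :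
    Summit.BirchSwinnertonDyer.BirchSwinnertonDyer.Theses.ByReductionTypeAtTwo.SupersingularRankZeroAtTwo ↔
      ∀ (W : WeierstrassCurve ℚ) [W.IsElliptic] [W.IsGloballyMinimal],
        ¬ W.HasCM → W.analyticRank = 0 → GoodSS W 2 →
        ∀ {N : ℕ} [NeZero N] (f : CuspForm (Gamma0 N) 2), IsNewformOf W f →
        ∀ (Ls Lf : IwasawaAlgebra 2), IsSprungPair f 2 (W.frobeniusTrace 2) Ls Lf →
          ∃ D : SignedDatum W 2, D.L = Lf ∧ D.EulerCharacteristic ∧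
            Ideal.span {D.L} = Ideal.span {D.xi} := by
  unfold Summit.BirchSwinnertonDyer.BirchSwinnertonDyer.Theses.ByReductionTypeAtTwo.SupersingularRankZeroAtTwo
  constructor
  · intro h W _ _ hcm hr hss N _ f hf Ls Lf hSP
    have hL : W.entireLFunction 1 ≠ 0 := (W.analyticRank_eq_zero_iff_holds (hmod' W)).1 hr
    exact flatDatumPackage_of_bsdp_two W hAU hGZK hss.1 hss.2 hL hf hSP (h W hcm hr hss)
  · intro h W _ _ hcm hr hss
    have hL : W.entireLFunction 1 ≠ 0 := (W.analyticRank_eq_zero_iff_holds (hmod' W)).1 hr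
    haveI : NeZero (W.conductorNorm ℤ) := ⟨(W.conductorNorm_pos_holds).ne'⟩
    -- the newform of `E` (modularity) and its Sprung pair at `2` (tree theorem)
    obtain ⟨Dm⟩ := hmod W
    have hf : IsNewformOf W Dm.f := Dm.isNewformOf
    obtain ⟨Ls, Lf, hSP⟩ := exists_isSprungPair_two hf hss.1 hss.2
    obtain ⟨D, hDL, hK, heq⟩ := h W hcm hr hss Dm.f hf Ls Lf hSP
    subst hDL
    exact bsdp_two_of_flatDatumPackage W hAU hGZK hss.1 hss.2 hL hf D hSP hK heq

end Degeneracy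

end Summit.BirchSwinnertonDyer.BirchSwinnertonDyer.Theorems

end
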